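import Summits.QuantumFields.YangMills.Theses.BalabanUVNodes
import Literature.MathematicalPhysics.QuantumFieldTheory.Balaban1983to89.Node00.Record13SepCoPH
import Summits.QuantumFields.YangMills.Theorems.BalabanUVNodesK2JsOfRecord
import Summits.QuantumFields.YangMills.Theorems.BalabanUVNodesK2NamedJetsRemAt

/-!
# DEF-1 RESHAPE SKETCH for crux K2⁷ `EndpointGivenBR13SepCoPH` (stmt-QuantumFields-20543) — EDITION 3: LINE 1′ «named jets» OVER THE LETTER OF RECORD
# `RemAt F κ θ hP c` EDITION 3 (constant remainder + per-scale anchor + (C), NORMALISATION CARRIED: the stub texts read the named numbers at the tuple's scale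
# `c := θ.cβ`, κ chosen AFTER θ), IMPORTED BY NAME from `Thm/BalabanUVNodesK2NamedJetsRemAt` (p593586)

Seat `ym-nodeO-def-1` (DEFINER; director-ym R361 ∕ LINE №200 ∕ LINE №203).  TRIGGERS: plan g80 (t-REM) RULING («K2⁷ v4 is cut the hour p590583 is LANDED+BUILT and DEF-1's
sketch ed.3 adopts the constant-remainder + anchor `RemAt` letter and∕or the CORE conjunct drop — or declines with reason») and director-ym LINE №203 (CRIT-1 g2 follow-through:
v3's pair STUB-MISSTATED modulo `TwoNormalisations`; «REQUIRED in the v4 cut ∕ DEF-1 letter ed.3: quantify κ AFTER θ AND carry θ.cβ in the identification + seam»).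
THIS IS A SPEC FOR THE PLANNER-OF-RECORD — «the reshape itself is theirs».  NOT a registered skeleton; NOT a proposal.  Sorries live ONLY in the four `stub_…` theorems;
every composition is sorry-free and concludes the crux decl BY NAME.

EDITION 3 = THE DECLARER's RULING: **ADOPT an4's weakening (constant remainder with the cap + per-scale anchor), P3's drop (ceiling conjuncts derived, not carried) AND
CRIT-1 g2's repair (normalisation carried, κ after θ).**  The letter is a TREE DEFINITION (one declarer, one definition — a v4 skeleton IMPORTS it and keeps only the two
one-line stub texts below + the by-name composition):
  `Summit.QuantumFields.YangMills.Theorems.BalabanUVNodesK2NamedJetsRemAt.RemAt F κ θ hP (c : ℝ) :=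
     ∃ γ₀ s, 0 < γ₀ ∧ γ₀ ≤ θ.γ ∧ s ≤ c · stepBal 2 F.L ∧ ConstRemainder (datum).βfun (fun k => c * beta0OfJs F κ k) s γ₀
       ∧ ScaleAnchor (datum).βfun (fun k => c * beta0OfJs F κ k) ∧ BetaContH γ₀ (datum).βfun`
(`datum := Node00.datumOfRecord₁₃SepCoPH F 2 θ hP`; `ConstRemainder β b r γ₀ := ∀ k p ∈ HistBox γ₀ k, |β k p − b k| ≤ r`; `ScaleAnchor β b := ∀ k δ>0 ∃ γ>0 ∀ p ∈ HistBox γ k, |β k p − b k| ≤ δ`).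
WHAT CHANGED vs ed.2 ∕ v3 (:172–:191):
* LETTER: linear modulus `C_r·p_k` → constant `s` with the cap `s ≤ θ.cβ · stepBal 2 F.L`; `0 ≤ C_r`, `0 ≤ β′`, `BetaUpperH β′ γ₀` DROPPED (the ceiling `θ.cβ·stepBal + 2θ.cβ·A + s` is
  DERIVED from stub 1′'s drift + the constant remainder: tree `constAnchorPackage_of_remAt_drift`); the per-scale anchor KEPT (load-bearing: it pins the shadowed numbers, so that
  stub 1′'s fixed slope is not refutable by a colour datum sitting a constant off); the reference numbers READ AT THE TUPLE's SCALE `θ.cβ • beta0OfJs F κ` (CRIT-1: the record's β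
  is degree-1 homogeneous in the free chart constant `θ.cβ`; the scale-free `∃ κ ∀ θ` pairs are killed modulo `TwoNormalisations`, p592392).
* STUB 2′: `∀ F, ∃ κ, ∀ θ hP, …` → `∀ F θ hP, θ.Admissible F 2 → ∃ κ, RemAt F κ θ hP θ.cβ` (κ AFTER θ).  STUB 1′: hypothesis re-keyed, conclusion UNCHANGED (bare slope `stepBal 2 F.L`).
* Stub NAMES unchanged (`stub_d1NamedJets13`, `stub_remNamedJets13` in the skeleton; Prop names `D1AtShadowingJets`, `RemAtSomeJets`); line 2 untouched (not restated here).
* LOCATED, NOT DECIDED: the β sub-cell's convention constant `c⋆` (if its stencil normalisation is an `IsSuChart` constant `c⋆ ≠ 1`, the texts read `θ.cβ / c⋆` — a one-token edit of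
  the two stub texts below; the tree letter is scale-parametric on purpose).  (P6) — the VALUE of κ — unpinned.
* NOT EXPOSED to CRIT-2 g2's `Negative/Anchor13FalseOfTwoBaseHistories` (p592695): that kill reads the DEFINITIONAL split's numbers (`limUnder` along `θ.v₀`); `RemAt` reads the record's
  β on boxes `]0,γ]^{k+1}` only and anchors it at NAMED numbers — two tuples differing only in `v₀` have the same β on every box, hence the same `RemAt`.
LATTICE (kernel, in the tree file): CRIT-1's repaired linear `RemAtN` ⟹ `RemAt … θ.cβ` (`remAt_of_remAtN`); v3's letter ∕ an4's 2″ are the instances `c = 1` (`remAt_one_of_v3Package`,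
`remAt_one_of_constAnchorPackage`); `remAt_rescale`: ONE κ serves a tuple and its rescaled twin (the two-normalisation witness MISSES the repaired pair).

HONEST FRAMING: typing asserts nothing of Bałaban's; K2⁷ NOT proved; every stub open (instance 0∕1); [I] Thm 2 + (0.31) p. 259 UNPROVED IN PRINT; R4 = conditional finite-𝕋⁴ rung
only — NOT continuum ∕ OS ∕ mass gap ∕ Clay.
-/

noncomputable section

open scoped Matrix.Norms.L2Operator

namespace Summit.QuantumFields.YangMills.Cruxes.EndpointGivenBR13SepCoPH.Def1NamedJetsSketch

open Literature.MathematicalPhysics.QuantumFieldTheory.Balaban1983to89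
open Literature.MathematicalPhysics.QuantumFieldTheory.Balaban1983to89.FlowStep
open Literature.MathematicalPhysics.QuantumFieldTheory.Balaban1983to89.FlowStepRuns (BetaPartialSumsLowerH)
open Literature.MathematicalPhysics.QuantumFieldTheory.Balaban1983to89.T4Continuum (T4Family)
open Literature.MathematicalPhysics.QuantumFieldTheory.Balaban1983to89.B12Beta (HistBox)
open Literature.MathematicalPhysics.QuantumFieldTheory.Balaban1983to89.Node00
open Literature.MathematicalPhysics.QuantumFieldTheory.Balaban1983to89.Beta.Drift (OneLoopDrift)
open Summit.QuantumFields.YangMills.Theorems.BalabanUVNodesK2JsOfRecord (StepColourData JsOfRecord beta0OfJs BoxRemainder)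
open Summit.QuantumFields.YangMills.Theorems.BalabanUVNodesK2NamedJetsRemAt
  (ConstRemainder ScaleAnchor RemAt EndpointGivenBR13SepCoPH_of_shadowingJets EndpointGivenBR13SepCoPH_of_namedJets remAt_of_remAtN
   d1AtShadowingJets_of_drift_of_anchor beta0OfJs_eq_of_remAt_adm constAnchorPackage_of_remAt_drift remAtSomeJets_of_remAtNamedJets)

/-! ## §B REGISTRATION (R-b), κ-free, κ AFTER θ — THE TWO STUB TEXTS OF LINE 1′, EDITION 3 (same Prop names as v3; bodies over the tree letter at scale `θ.cβ`) -/

/-- STUB 2′ TEXT (R-b, ed.3) «rows (D4) ∧ B4 at print's CONSTANT grade (cap `s ≤ θ.cβ·stepBal 2 F.L`) + the per-scale anchor + (C), at the tuple's chart scale — the XL stub CHOOSES κ,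
PER TUPLE»: at every admissible proviso'd Stage-13 tuple SOME colour datum's named numbers, read at scale `θ.cβ`, shadow the record's β (`RemAt`, tree letter ed.3).  (= CRIT-1 g2's
`RemAtNEachJets` shape at constant grade.)  (P6) UNPINNED.  Size XL (wall = NODE O). -/
def RemAtSomeJets : Prop :=
  ∀ (F : T4Family) (θ : Node00.Stage13HParams F 2) (hP : θ.Provisos₁₃SepCoPH F 2), θ.Admissible F 2 →
    ∃ κ : StepColourData, RemAt F κ θ hP θ.cβ

/-- STUB 1′ TEXT (R-b, ed.3) «row (D1) at the record, carried by the named jets»: whenever a colour datum's named numbers, read at scale `θ.cβ`, shadow the record's β at an admissible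
proviso'd tuple (`RemAt` ed.3), the BARE named numbers drift with slope `stepBal 2 F.L` — the conclusion IS `D1Drift F.L (JsOfRecord F κ) 2 0 1` (`d1Drift_JsOfRecord_iff`, `Iff.rfl`;
instance-free spelling).  By the anchor this is ONE drift statement per record (all shadowing κ share the numbers, `beta0OfJs_eq_of_remAt_adm`).  Size L (+ transfer). -/
def D1AtShadowingJets : Prop :=
  ∀ (F : T4Family) (κ : StepColourData) (θ : Node00.Stage13HParams F 2) (hP : θ.Provisos₁₃SepCoPH F 2), θ.Admissible F 2 →
    RemAt F κ θ hP θ.cβ → ∃ A : ℝ, OneLoopDrift (B12Normalization.stepBal 2 F.L) A (beta0OfJs F κ)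

/-- THE COMPOSITION (R-b), ed.3 — the tree's `EndpointGivenBR13SepCoPH_of_shadowingJets` BY NAME (its inline hypotheses ARE the two texts above, definitionally): stub 1′ → stub 2′ →
the crux decl BY NAME (per record: κ from 2′, bare drift from 1′, rescaled by `θ.cβ`, an4's END with the ceiling derived).  Kernel-checked, no sorry. -/
theorem EndpointGivenBR13SepCoPH_of_shadowingJets' (h₁ : D1AtShadowingJets) (h₂ : RemAtSomeJets) :
    Summit.QuantumFields.YangMills.Theses.BalabanUVNodes.EndpointGivenBR13SepCoPH :=
  EndpointGivenBR13SepCoPH_of_shadowingJets h₁ h₂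

/-- STUB 1′ (R-b, ed.3) — registered name `stub_d1NamedJets13` in v3 ∕ v4.  Size L (+ transfer). -/
theorem stub_d1ShadowingJets : D1AtShadowingJets := by
  sorry

/-- STUB 2′ (R-b, ed.3) — registered name `stub_remNamedJets13` in v3 ∕ v4.  Size XL. -/
theorem stub_remSomeJets : RemAtSomeJets := by
  sorry

/-- REGISTRATION FORM (R-b), ed.3: the crux decl BY NAME from the two κ-free stubs. -/
theorem EndpointGivenBR13SepCoPH_proof_Rb : Summit.QuantumFields.YangMills.Theses.BalabanUVNodes.EndpointGivenBR13SepCoPH :=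
  EndpointGivenBR13SepCoPH_of_shadowingJets stub_d1ShadowingJets stub_remSomeJets

/-- USE FORM for the row-(D1) owner, KEYED ON THE ANCHOR (tree `d1AtShadowingJets_of_drift_of_anchor` BY NAME): «every colour datum whose `θ.cβ`-scaled named numbers are ANCHORED at an
admissible proviso'd record drifts at the bare slope `stepBal 2 F.L`» discharges stub 1′. -/
theorem d1AtShadowingJets_of_drift_of_anchor'
    (h : ∀ (F : T4Family) (κ : StepColourData) (θ : Node00.Stage13HParams F 2) (hP : θ.Provisos₁₃SepCoPH F 2), θ.Admissible F 2 →
      ScaleAnchor (Node00.datumOfRecord₁₃SepCoPH F 2 θ hP).βfun (fun k => θ.cβ * beta0OfJs F κ k) →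
      ∃ A : ℝ, OneLoopDrift (B12Normalization.stepBal 2 F.L) A (beta0OfJs F κ)) :
    D1AtShadowingJets :=
  d1AtShadowingJets_of_drift_of_anchor h

/-! ## §C THE RE-CUT AGAINST CRIT-1 g2's REPAIRED LINEAR PAIR (kernel): `RemAtNEachJets` ⟹ ed.3's 2′; ed.3's 1′ ⟹ `D1AtNShadowingJets` (texts VERBATIM, `NamedJetsNormalisation.lean` :263–:277) -/

/-- CRIT-1's REPAIRED stub 2′ᴺ `RemAtNEachJets` (linear, κ after θ, scale `θ.cβ`; letter `RemAtN` unfolded VERBATIM) ⟹ ed.3's `RemAtSomeJets` (tree `remAt_of_remAtN`). -/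
theorem remAtSomeJets_of_crit1
    (h : ∀ (F : T4Family) (θ : Node00.Stage13HParams F 2) (hP : θ.Provisos₁₃SepCoPH F 2), θ.Admissible F 2 → ∃ κ : StepColourData,
      ∃ γ₀ Cr β' : ℝ, 0 < γ₀ ∧ γ₀ ≤ θ.γ ∧ 0 ≤ Cr ∧ 0 ≤ β' ∧
        BoxRemainder (Node00.datumOfRecord₁₃SepCoPH F 2 θ hP).βfun (fun k => θ.cβ * beta0OfJs F κ k) Cr γ₀ ∧
        Cr * γ₀ ≤ θ.cβ * B12Normalization.stepBal 2 F.L ∧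
        BetaContH γ₀ (Node00.datumOfRecord₁₃SepCoPH F 2 θ hP).βfun ∧
        BetaUpperH β' γ₀ (Node00.datumOfRecord₁₃SepCoPH F 2 θ hP).βfun) :
    RemAtSomeJets := fun F θ hP hθ => by
  obtain ⟨κ, hκ⟩ := h F θ hP hθ
  exact ⟨κ, remAt_of_remAtN F κ θ hP hκ⟩

/-- ed.3's `D1AtShadowingJets` ⟹ CRIT-1's REPAIRED stub 1′ᴺ `D1AtNShadowingJets` (letter `RemAtN` unfolded VERBATIM; tree `remAt_of_remAtN`). -/
theorem crit1Stub1_of_d1AtShadowingJets (h₁ : D1AtShadowingJets) :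
    ∀ (F : T4Family) (κ : StepColourData) (θ : Node00.Stage13HParams F 2) (hP : θ.Provisos₁₃SepCoPH F 2), θ.Admissible F 2 →
      (∃ γ₀ Cr β' : ℝ, 0 < γ₀ ∧ γ₀ ≤ θ.γ ∧ 0 ≤ Cr ∧ 0 ≤ β' ∧
        BoxRemainder (Node00.datumOfRecord₁₃SepCoPH F 2 θ hP).βfun (fun k => θ.cβ * beta0OfJs F κ k) Cr γ₀ ∧
        Cr * γ₀ ≤ θ.cβ * B12Normalization.stepBal 2 F.L ∧
        BetaContH γ₀ (Node00.datumOfRecord₁₃SepCoPH F 2 θ hP).βfun ∧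
        BetaUpperH β' γ₀ (Node00.datumOfRecord₁₃SepCoPH F 2 θ hP).βfun) →
      ∃ A : ℝ, OneLoopDrift (B12Normalization.stepBal 2 F.L) A (beta0OfJs F κ) :=
  fun F κ θ hP hθ hN => h₁ F κ θ hP hθ (remAt_of_remAtN F κ θ hP hN)

/-- THE CEILING + FLOOR A K1-SIDE READER WANTS, from the two ed.3 stub texts at one record (tree `constAnchorPackage_of_remAt_drift`, `c := θ.cβ`): (A-ps) `BetaPartialSumsLowerH (2|θ.cβ|A) γ₀`
and `BetaUpperH (θ.cβ·stepBal 2 F.L + 2|θ.cβ|A + s) γ₀` of the record's β on the letter's box. -/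
theorem floor_ceiling_of_stubs (h₁ : D1AtShadowingJets) (F : T4Family) (κ : StepColourData) (θ : Node00.Stage13HParams F 2) (hP : θ.Provisos₁₃SepCoPH F 2)
    (hθ : θ.Admissible F 2) (hRem : RemAt F κ θ hP θ.cβ) :
    ∃ A γ₀ s : ℝ, 0 < γ₀ ∧ γ₀ ≤ θ.γ ∧ 0 ≤ s ∧ s ≤ θ.cβ * B12Normalization.stepBal 2 F.L ∧
      BetaPartialSumsLowerH (2 * (|θ.cβ| * A)) γ₀ (Node00.datumOfRecord₁₃SepCoPH F 2 θ hP).βfun ∧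
      BetaUpperH (θ.cβ * B12Normalization.stepBal 2 F.L + 2 * (|θ.cβ| * A) + s) γ₀ (Node00.datumOfRecord₁₃SepCoPH F 2 θ hP).βfun := by
  obtain ⟨A, hdrift⟩ := h₁ F κ θ hP hθ hRem
  obtain ⟨γ₀, s, hγ₀, hγθ, hs, hcap, -, -, -, hps, hup⟩ := constAnchorPackage_of_remAt_drift F κ θ hP hRem hdrift
  exact ⟨A, γ₀, s, hγ₀, hγθ, hs, hcap, hps, hup⟩

/-- THE IDENTIFICATION under ed.3 (tree `beta0OfJs_eq_of_remAt_adm`): two data shadowing the same ADMISSIBLE record at its scale have the same named numbers — κ is no free knob. -/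
theorem sameNumbers_of_remAt (F : T4Family) (κ κ' : StepColourData) (θ : Node00.Stage13HParams F 2) (hP : θ.Provisos₁₃SepCoPH F 2) (hθ : θ.Admissible F 2)
    (h : RemAt F κ θ hP θ.cβ) (h' : RemAt F κ' θ hP θ.cβ) : beta0OfJs F κ = beta0OfJs F κ' :=
  beta0OfJs_eq_of_remAt_adm F κ κ' θ hP hθ h h'

/-! ## §A REGISTRATION (R-a) at a PINNED colour map `κBal : ℕ → StepColourData` (post-(P6); a PARAMETER here — (P6) is UNPINNED in the tree) -/

/-- STUB 1′ TEXT (R-a, ed.3) «row (D1) over the named jets VERBATIM» at the pin. -/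
def D1AtNamedJets (κ : ℕ → StepColourData) : Prop :=
  ∀ F : T4Family, ∃ A : ℝ, OneLoopDrift (B12Normalization.stepBal 2 F.L) A (beta0OfJs F (κ F.L))

/-- STUB 2′ TEXT (R-a, ed.3): the tree letter at `κ F.L` and scale `θ.cβ`, every admissible proviso'd record. -/
def RemAtNamedJets (κ : ℕ → StepColourData) : Prop :=
  ∀ (F : T4Family) (θ : Node00.Stage13HParams F 2) (hP : θ.Provisos₁₃SepCoPH F 2), θ.Admissible F 2 → RemAt F (κ F.L) θ hP θ.cβ

section StubsRa

variable (κBal : ℕ → StepColourData)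

/-- STUB 1′ (R-a, ed.3; registrable once `κBal` is a definition of record). -/
theorem stub_d1NamedJets : D1AtNamedJets κBal := by
  sorry

/-- STUB 2′ (R-a, ed.3). -/
theorem stub_remNamedJets : RemAtNamedJets κBal := by
  sorry

/-- REGISTRATION FORM (R-a), ed.3: the crux decl BY NAME from the two stubs at the pin (tree `EndpointGivenBR13SepCoPH_of_namedJets`). -/
theorem EndpointGivenBR13SepCoPH_proof_Ra (κBal : ℕ → StepColourData) :
    Summit.QuantumFields.YangMills.Theses.BalabanUVNodes.EndpointGivenBR13SepCoPH :=
  EndpointGivenBR13SepCoPH_of_namedJets κBal (stub_d1NamedJets κBal) (stub_remNamedJets κBal)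

/-- (R-a) at any pin ⟹ (R-b)'s stub-2′ text (tree `remAtSomeJets_of_remAtNamedJets`). -/
theorem remAtSomeJets_of_pinned (h : RemAtNamedJets κBal) : RemAtSomeJets :=
  remAtSomeJets_of_remAtNamedJets κBal h

end StubsRa

end Summit.QuantumFields.YangMills.Cruxes.EndpointGivenBR13SepCoPH.Def1NamedJetsSketch

end
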